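import Summits.NavierStokesRegularity.NavierStokesRegularity.Theorems.FluidComputerLocal
import Literature.Analysis.FluidPDE.Tao2016AveragedNS.GateCertificate
import HarnessLib

/-!
# Fluid computer, LOCAL layer × Tao's certified gate: what is left is `GatePhysics`

HONEST FRAMING (verbatim, blueprint-wide): low prior, high value-of-information experiment on Tao's
machine paradigm; NOT a claim that NS blows up. No `GatePhysics` for the true equations is known to
exist; every theorem below is an implication from such a (so far uninhabited) structure.

`FluidComputerLocal` recorded what a `LocalCircuit S O s` (bp3 gen 7) buys for the true equations.
`Literature…Tao2016AveragedNS.GateCertificate` (bp1 gen 9) splits that structure, definitionally,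
into its finite-dimensional half `GateCertificate O` (regions, design field, flow, tube, defect
budget, delayed abrupt transition with margin) and the fluid half `GatePhysics S O s c` (readout,
junk, statics, clock, the two guarded a-priori inequalities `defect` / `junk_rate` about every
`H¹⁰_df`-mild Navier–Stokes trajectory, seed), and INHABITS the first half by Tao's delay circuit
(5.5): `taoGate (h : GateBudget K ε ρ εd θ) : GateCertificate (Fin 5 → ℝ)` — a theorem (Theorem 5.3
as proved in the tree, its trigger tolerance, global well-posedness, the fundamental lemma).

This file composes the two at the summit: a `GatePhysics` over ANY gate certificate refutes Clay (A)
(`ns_blowup_of_gateCertificate`); in particular a `GatePhysics S (Fin 5 → ℝ) s (taoGate h)` —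
readout / junk / statics / clock / seed and the two guarded inequalities, wired to Tao's gate with
its certified constants (working region the sup-ball of radius `2`, defect `εd` per rescaled unit
time, cycle `τc = 2`) — refutes it (`ns_blowup_of_taoGatePhysics`), with stable blow-up near the seed
(`stableBlowup_of_taoGatePhysics`) and the readout of the true solution following Tao's delay
circuit `delayFlow K ε` to within `εd σ e^{Lσ}`, `L = delayLipschitz K ε 2`, during each tick
(`readout_tracks_delayCircuit_of_taoGatePhysics`). What is thereby kernel-checked is the SHAPE of
the remaining burden for a Tao-type gate: it is exactly the field list of `GatePhysics`, nothing
finite-dimensional. Nothing here lowers that burden. [cite: Tao2016AveragedNS, §1.3 pp. 10–11]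
-/

open Set Filter Topology
open scoped SchwartzMap ENNReal NNReal

set_option linter.dupNamespace false -- nested layout Summit.<S>.<Sub>, Sub = S (D-0017)

namespace Summit.NavierStokesRegularity.NavierStokesRegularity.Theorems.FluidComputer

open Literature.Analysis.FluidPDE Literature.Analysis.FluidPDE.Tao2016
open Literature.Analysis.FluidPDE.FluidComputer
open Literature.Analysis.FluidPDE.Tao2016AveragedNS (GateCertificate GatePhysics GateBudget taoGate
  delayFlow delayLipschitz trigIn)

variable {S : CascadeSpecs} {O : Type*} [NormedAddCommGroup O] [NormedSpace ℝ O] {s : ℝ}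

/-- **Certificate + physics refute Clay (A)** (`α > 0`, `η > 1/4`): a gate certificate `c` over any
observable space together with a `GatePhysics S O s c` for the true Navier–Stokes equations is a
`LocalCircuit`, hence `¬ NavierStokesRegularity`. HONEST FRAMING: an implication from an
uninhabited-as-far-as-known structure; NOT a claim that NS blows up. -/
theorem ns_blowup_of_gateCertificate (c : GateCertificate O) (P : GatePhysics S O s c)
    (hα : 0 < S.alpha) (hη : 1 / 4 < S.eta) : ¬ NavierStokesRegularity :=
  ns_blowup_of_localCircuit (c.localCircuit P) hα hη

/-- **Tao's gate leaves exactly `GatePhysics`**: under a gate budget `GateBudget K ε ρ εd θ`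
(`K ≥ K₀`, `0 < ε ≤ ε₁(K)`, `(ρ + 2εd)e^{2L} ≤ θ ≤ 1/4`), a `GatePhysics S (Fin 5 → ℝ) s (taoGate h)`
for the true equations refutes Clay (A) (`α > 0`, `η > 1/4`) — the finite-dimensional half being
the THEOREM `taoGate h`. HONEST FRAMING as above. -/
theorem ns_blowup_of_taoGatePhysics {K ε ρ εd θ : ℝ} (h : GateBudget K ε ρ εd θ)
    (P : GatePhysics S (Fin 5 → ℝ) s (taoGate h)) (hα : 0 < S.alpha) (hη : 1 / 4 < S.eta) :
    ¬ NavierStokesRegularity :=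
  ns_blowup_of_gateCertificate (taoGate h) P hα hη

/-- **Stable blow-up near the seed, Tao's gate** (`0 ≤ s`): every divergence-free Schwartz datum
`X^s_{λ₀}`-close to the seed of the physics (radius `min ((ρ/2)/Λ) (jin - jcore) · √E₀`, the core
thickness `ρ/2` being the certificate's) has all its `H¹⁰_df`-mild trajectories of lifespan `≤ T_*`. -/
theorem stableBlowup_of_taoGatePhysics {K ε ρ εd θ : ℝ} (h : GateBudget K ε ρ εd θ)
    (P : GatePhysics S (Fin 5 → ℝ) s (taoGate h)) (hs : 0 ≤ s) (hα : 0 < S.alpha)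
    (hη : 1 / 4 < S.eta) (w₀ : 𝓢(EuclideanSpace ℝ (Fin 3), EuclideanSpace ℝ (Fin 3)))
    (hdiv : VectorCalculus.IsDivFree ⇑w₀)
    (hnear : scaledSobolevNorm s (S.lam 0) (schwartzL2 w₀ - schwartzL2 P.u₀) <
      ENNReal.ofReal (((taoGate h).localCircuit P).toShadowedCircuit.rho * Real.sqrt (S.Emin 0)))
    {S' : ℝ} {u : ℝ → L2C} (hu : IsMildSolutionFor eulerForm (schwartzL2 w₀) (Ico 0 S') u) :
    S' ≤ S.Tstar :=
  stableBlowup_of_localCircuit ((taoGate h).localCircuit P) hs hα hη w₀ hdiv hnear hu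

/-- **The true solution is seen running Tao's delay circuit**: along the seed's maximal
`H¹⁰_df`-mild trajectory `U` on `[0, S_m)`, `S_m ≤ T_*`, at clocked instants `0 = t₀ ≤ t₁ ≤ …` the
generation-`n` readout is an admissible input of the certified gate (`∈ trigIn K ε ρ`), and during
generation `n`'s tick (rescaled time `σ ≤ 2`) the readout of the TRUE solution is within
`εd σ e^{Lσ}`, `L = delayLipschitz K ε 2`, of Tao's flow `delayFlow K ε σ` from it — for as long
as the trajectory lives. HONEST FRAMING as above. -/
theorem readout_tracks_delayCircuit_of_taoGatePhysics {K ε ρ εd θ : ℝ} (h : GateBudget K ε ρ εd θ)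
    (P : GatePhysics S (Fin 5 → ℝ) s (taoGate h)) (hα : 0 < S.alpha) (hη : 1 / 4 < S.eta)
    (hctrl : ((taoGate h).localCircuit P).toShadowedCircuit.H10Control) :
    ∃ Sm : ℝ, 0 < Sm ∧ Sm ≤ S.Tstar ∧ ∃ U : ℝ → L2C,
      IsMildSolutionFor eulerForm (schwartzL2 P.u₀) (Ico 0 Sm) U ∧
      ∃ t : ℕ → ℝ, t 0 = 0 ∧ Monotone t ∧ (∀ n, t n < Sm) ∧
        (∀ n, P.read n (U (t n)) ∈ trigIn K ε ρ) ∧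
        ∀ n σ, 0 ≤ σ → σ ≤ 2 → t n + P.unit n * σ < Sm →
          dist (P.read n (U (t n + P.unit n * σ))) (delayFlow K ε σ (P.read n (U (t n)))) ≤
            εd * σ * Real.exp (delayLipschitz K ε 2 * σ) := by
  obtain ⟨Sm, hSm, hle, U, hU, t, ht0, htmono, htlt, hmem, hsharp⟩ :=
    readout_tracks_circuit_of_localCircuit ((taoGate h).localCircuit P) hα hη hctrl
  refine ⟨Sm, hSm, hle, U, hU, t, ht0, htmono, htlt, fun n => (hmem n).1, fun n σ hσ0 hστ hlt => ?_⟩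
  exact (hsharp n σ hσ0 hστ hlt).1.trans
    (BDSV.gronwallBound_zero_le (delayLipschitz K ε 2).coe_nonneg h.εd_nonneg)

end Summit.NavierStokesRegularity.NavierStokesRegularity.Theorems.FluidComputer
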